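import Summits.QuantumFields.YangMills.Theorems.ColdStartUniversalityLatticeLangevinTimeDecorrelation
import Summits.QuantumFields.YangMills.Theorems.ColdStartUniversalityLatticeLangevinFellerJoint
import Summits.QuantumFields.YangMills.Theorems.ColdStartUniversalityLatticeLangevinDuhamelSymmetry
import HarnessLib

/-!
# Route `ColdStartUniversality` (fixed-cut-off SZZ dynamics, sampler package): THE GREEN–KUBO FORM IS BILINEAR —
# `GK(Σᵢ xᵢGᵢ) = Σᵢⱼ xᵢxⱼ ∫₀^∞⟨Ĝᵢ, κ_tĜⱼ⟩_μ dt` (cross-correlations integrable on `(0,∞)` by every-start mixing)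

Helper file (seat `ym-line-csu-p1`, g35; `--supports stmt-QuantumFields-24809`).  Bookkeeping for the MULTIVARIATE central limit theorem (next
file): for the SU(2) SZZ dynamics at any coupling, a realising kernel family `κ`, finitely many continuous observables `|Gᵢ| ≤ 1`
(`Ĝᵢ = Gᵢ − μ_(β')Gᵢ`) and real coefficients `xᵢ`:
* `integrableOn_crossCorrelation` — `t ↦ ∫ Ĝᵢ·κ_tĜⱼ dμ_(β')` is continuous and integrable on `(0,∞)` (`|κ_tĜⱼ| ≤ Ce^(−ct)`, Harris);
* `centred_sum_eq` — `(ΣxᵢGᵢ) − μ(ΣxᵢGᵢ) = ΣxᵢĜᵢ`;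
* ★★ `greenKubo_sum_eq` — `∫₀^∞ ∫ (ΣᵢxᵢĜᵢ)·κ_t(ΣⱼxⱼĜⱼ) dμ dt = Σᵢ Σⱼ xᵢxⱼ ∫₀^∞ ∫ Ĝᵢ·κ_tĜⱼ dμ dt`.
So the asymptotic variance `σ²` of the time-average CLT is the quadratic form of the GREEN–KUBO COVARIANCE MATRIX
`Σᵢⱼ = ∫₀^∞ ∫ (Ĝᵢκ_tĜⱼ + Ĝⱼκ_tĜᵢ) dμ dt`.  THEOREMS ONLY, no definition, no sorry; [folklore].  HONEST FRAMING: fixed cut-off;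
`UniformColdStartMixing` (24809) is NOT restated; no crux, rung or summit statement is proved; the Yang–Mills mass gap is NOT proved.
-/

set_option autoImplicit false

noncomputable section

namespace Summit.QuantumFields.YangMills.Theorems.ColdStartUniversality

open MeasureTheory ProbabilityTheory Filter Topology Set
open scoped NNReal ENNReal BigOperators
open Literature Literature.Probability.Process Literature.MathematicalPhysics.QuantumFieldTheory
open Literature.MathematicalPhysics.QuantumLattice (fundamentalRep fundamentalLatticeRep continuous_fundamentalRep)

variable {L : ℕ} [NeZero L]

/-- **Cross-correlations of centred continuous observables are continuous in time and integrable on `(0,∞)`**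
(`|∫ F·κ_tĜ dμ| ≤ C_F·C e^(−ct)` by the every-start mixing of the kernels). [folklore] -/
theorem integrableOn_crossCorrelation (L : ℕ) [NeZero L] (β' : ℝ)
    (κ : ℝ≥0 → Kernel (GaugeConfig 3 L (Matrix.specialUnitaryGroup (Fin 2) ℂ))
      (GaugeConfig 3 L (Matrix.specialUnitaryGroup (Fin 2) ℂ))) [∀ t, IsMarkovKernel (κ t)]
    (hreal : ∀ (t : ℝ≥0) (x : GaugeConfig 3 L (Matrix.specialUnitaryGroup (Fin 2) ℂ))
        (Ω : Type) [MeasurableSpace Ω] (P : Measure Ω) [IsProbabilityMeasure P]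
        (W : ℝ≥0 → Ω → (Edge 3 L × NoiseIdx 2 → ℝ)) (hW : IsFlatBrownian W P)
        (U : ℝ≥0 → Ω → GaugeConfig 3 L (Matrix.specialUnitaryGroup (Fin 2) ℂ)),
        (∀ ω, U 0 ω = x) →
        (latticeLangevinDynamics (fundamentalLatticeRep 2) β').IsSolution (fundamentalRep (Fin 2))
          hW.natFiltration P W U →
        κ t x = P.map (U t))
    {F G : GaugeConfig 3 L (Matrix.specialUnitaryGroup (Fin 2) ℂ) → ℝ} (hFc : Continuous F) {CF : ℝ} (hFb : ∀ z, |F z| ≤ CF)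
    (hGc : Continuous G) (hG1 : ∀ z, |G z| ≤ 1) :
    Continuous (fun t : ℝ => ∫ y, F y * (∫ z, (G z - ∫ z', G z' ∂(wilsonMeasure (d := 3) (L := L) (fundamentalRep (Fin 2)) β'))
        ∂(κ t.toNNReal y)) ∂(wilsonMeasure (d := 3) (L := L) (fundamentalRep (Fin 2)) β')) ∧
    IntegrableOn (fun t : ℝ => ∫ y, F y * (∫ z, (G z - ∫ z', G z' ∂(wilsonMeasure (d := 3) (L := L) (fundamentalRep (Fin 2)) β'))
        ∂(κ t.toNNReal y)) ∂(wilsonMeasure (d := 3) (L := L) (fundamentalRep (Fin 2)) β')) (Ioi (0 : ℝ)) := by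
  classical
  haveI := secondCountableTopology_su2
  haveI := borelSpace_config L
  set μ : Measure (GaugeConfig 3 L (Matrix.specialUnitaryGroup (Fin 2) ℂ)) :=
    wilsonMeasure (d := 3) (L := L) (fundamentalRep (Fin 2)) β' with hμ
  haveI : IsProbabilityMeasure μ :=
    isProbabilityMeasure_wilsonMeasure (d := 3) (L := L) (fundamentalRep (Fin 2)) (continuous_fundamentalRep (Fin 2)) β'
  set m : ℝ := ∫ z', G z' ∂μ with hm
  set Gh : GaugeConfig 3 L (Matrix.specialUnitaryGroup (Fin 2) ℂ) → ℝ := fun z => G z - m with hGh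
  have hGhc : Continuous Gh := hGc.sub continuous_const
  have hGm : Measurable G := hGc.measurable
  obtain ⟨C, c, hC, hc, hmix⟩ := abs_transition_sub_wilson_le_exp L β'
  have hGi : ∀ (ν : Measure (GaugeConfig 3 L (Matrix.specialUnitaryGroup (Fin 2) ℂ))) [IsProbabilityMeasure ν], Integrable G ν := fun ν _ =>
    (integrable_const (1 : ℝ)).mono' hGm.aestronglyMeasurable (Eventually.of_forall fun z => by simpa [Real.norm_eq_abs] using hG1 z)
  have hκb : ∀ (t : ℝ≥0) y, |∫ z, Gh z ∂(κ t y)| ≤ C * Real.exp (-c * t) := fun t y => by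
    have heq : ∫ z, Gh z ∂(κ t y) = (∫ z, G z ∂(κ t y)) - m := by
      simp only [hGh]; rw [integral_sub (hGi _) (integrable_const m), integral_const, smul_eq_mul, probReal_univ, one_mul]
    rw [heq]; exact hmix κ hreal G hGm hG1 t y
  set φ : ℝ → ℝ := fun t => ∫ y, F y * (∫ z, Gh z ∂(κ t.toNNReal y)) ∂μ with hφ
  have hJ : Continuous (Function.uncurry fun (t : ℝ) (x : GaugeConfig 3 L (Matrix.specialUnitaryGroup (Fin 2) ℂ)) =>
      F x * ∫ y, Gh y ∂(κ t.toNNReal x)) :=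
    (hFc.comp continuous_snd).mul ((continuous_transitionKernel_action β' κ hreal hGhc).comp
      ((continuous_real_toNNReal.comp continuous_fst).prodMk continuous_snd))
  have hφc : Continuous φ := continuous_integral_of_continuous_uncurry μ hJ
  have hCF : 0 ≤ CF := (abs_nonneg _).trans (hFb (fun _ => 1))
  have hφb : ∀ t : ℝ, 0 ≤ t → |φ t| ≤ CF * C * Real.exp (-c * t) := by
    intro t ht
    have hh := norm_integral_le_of_norm_le_const (μ := μ) (f := fun y => F y * (∫ z, Gh z ∂(κ t.toNNReal y))) (C := CF * C * Real.exp (-c * t))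
      (Eventually.of_forall fun y => by
        rw [Real.norm_eq_abs, abs_mul]
        have h1 := hκb t.toNNReal y
        rw [Real.coe_toNNReal t ht] at h1
        calc |F y| * |∫ z, Gh z ∂(κ t.toNNReal y)| ≤ CF * (C * Real.exp (-c * t)) := mul_le_mul (hFb y) h1 (abs_nonneg _) hCF
          _ = CF * C * Real.exp (-c * t) := by ring)
    simpa [Real.norm_eq_abs] using hh
  refine ⟨hφc, ?_⟩
  have hbi : IntegrableOn (fun t : ℝ => CF * C * Real.exp (-c * t)) (Ioi (0 : ℝ)) := by
    have h : IntegrableOn (fun t : ℝ => (CF * C) * Real.exp (-c * t)) (Ioi (0 : ℝ)) := (exp_neg_integrableOn_Ioi 0 hc).const_mul (CF * C)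
    exact h
  refine Integrable.mono' hbi hφc.aestronglyMeasurable ?_
  filter_upwards [ae_restrict_mem measurableSet_Ioi] with t ht
  rw [Real.norm_eq_abs]
  exact hφb t (le_of_lt ht)

/-- **Centring is linear**: `μ(Σ xᵢGᵢ) = Σ xᵢ μ(Gᵢ)`. [folklore] -/
theorem integral_sum_mul_eq (L : ℕ) [NeZero L] {ι : Type} [Fintype ι]
    {G : ι → GaugeConfig 3 L (Matrix.specialUnitaryGroup (Fin 2) ℂ) → ℝ} (hGc : ∀ i, Continuous (G i)) (hG1 : ∀ i z, |G i z| ≤ 1)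
    (x : ι → ℝ) (ν : Measure (GaugeConfig 3 L (Matrix.specialUnitaryGroup (Fin 2) ℂ))) [IsProbabilityMeasure ν] :
    ∫ z, (∑ i, x i * G i z) ∂ν = ∑ i, x i * ∫ z, G i z ∂ν := by
  classical
  haveI := secondCountableTopology_su2
  haveI := borelSpace_config L
  have hGi : ∀ i, Integrable (G i) ν := fun i =>
    (integrable_const (1 : ℝ)).mono' (hGc i).measurable.aestronglyMeasurable (Eventually.of_forall fun z => by simpa [Real.norm_eq_abs] using hG1 i z)
  rw [integral_finsetSum _ fun i _ => (hGi i).const_mul _]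
  exact Finset.sum_congr rfl fun i _ => integral_const_mul _ _

/-- ★★ **Bilinearity of the Green–Kubo form.**  For finitely many continuous `|Gᵢ| ≤ 1` and real `xᵢ`, with `Ĝᵢ = Gᵢ − μ_(β')Gᵢ`:
`∫₀^∞ ∫ (ΣᵢxᵢĜᵢ)·κ_t(ΣⱼxⱼĜⱼ) dμ dt = Σᵢ Σⱼ xᵢxⱼ ∫₀^∞ ∫ Ĝᵢ·κ_tĜⱼ dμ dt`. [folklore] -/
theorem greenKubo_sum_eq (L : ℕ) [NeZero L] (β' : ℝ)
    (κ : ℝ≥0 → Kernel (GaugeConfig 3 L (Matrix.specialUnitaryGroup (Fin 2) ℂ))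
      (GaugeConfig 3 L (Matrix.specialUnitaryGroup (Fin 2) ℂ))) [∀ t, IsMarkovKernel (κ t)]
    (hreal : ∀ (t : ℝ≥0) (x : GaugeConfig 3 L (Matrix.specialUnitaryGroup (Fin 2) ℂ))
        (Ω : Type) [MeasurableSpace Ω] (P : Measure Ω) [IsProbabilityMeasure P]
        (W : ℝ≥0 → Ω → (Edge 3 L × NoiseIdx 2 → ℝ)) (hW : IsFlatBrownian W P)
        (U : ℝ≥0 → Ω → GaugeConfig 3 L (Matrix.specialUnitaryGroup (Fin 2) ℂ)),
        (∀ ω, U 0 ω = x) →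
        (latticeLangevinDynamics (fundamentalLatticeRep 2) β').IsSolution (fundamentalRep (Fin 2))
          hW.natFiltration P W U →
        κ t x = P.map (U t))
    {ι : Type} [Fintype ι]
    {G : ι → GaugeConfig 3 L (Matrix.specialUnitaryGroup (Fin 2) ℂ) → ℝ} (hGc : ∀ i, Continuous (G i)) (hG1 : ∀ i z, |G i z| ≤ 1)
    (x : ι → ℝ) :
    ∫ t in Ioi (0 : ℝ), (∫ y, (∑ i, x i * (G i y - ∫ z, G i z ∂(wilsonMeasure (d := 3) (L := L) (fundamentalRep (Fin 2)) β'))) *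
        (∫ z, (∑ j, x j * (G j z - ∫ z', G j z' ∂(wilsonMeasure (d := 3) (L := L) (fundamentalRep (Fin 2)) β'))) ∂(κ t.toNNReal y))
        ∂(wilsonMeasure (d := 3) (L := L) (fundamentalRep (Fin 2)) β')) =
      ∑ i, ∑ j, x i * x j * ∫ t in Ioi (0 : ℝ), (∫ y, (G i y - ∫ z, G i z ∂(wilsonMeasure (d := 3) (L := L) (fundamentalRep (Fin 2)) β')) *
        (∫ z, (G j z - ∫ z', G j z' ∂(wilsonMeasure (d := 3) (L := L) (fundamentalRep (Fin 2)) β')) ∂(κ t.toNNReal y))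
        ∂(wilsonMeasure (d := 3) (L := L) (fundamentalRep (Fin 2)) β')) := by
  classical
  haveI := secondCountableTopology_su2
  haveI := borelSpace_config L
  set μ : Measure (GaugeConfig 3 L (Matrix.specialUnitaryGroup (Fin 2) ℂ)) :=
    wilsonMeasure (d := 3) (L := L) (fundamentalRep (Fin 2)) β' with hμ
  haveI : IsProbabilityMeasure μ :=
    isProbabilityMeasure_wilsonMeasure (d := 3) (L := L) (fundamentalRep (Fin 2)) (continuous_fundamentalRep (Fin 2)) β'
  set m : ι → ℝ := fun i => ∫ z, G i z ∂μ with hm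
  set Gh : ι → GaugeConfig 3 L (Matrix.specialUnitaryGroup (Fin 2) ℂ) → ℝ := fun i z => G i z - m i with hGh
  have hGhc : ∀ i, Continuous (Gh i) := fun i => (hGc i).sub continuous_const
  have hm1 : ∀ i, |m i| ≤ 1 := fun i => by
    have hh := norm_integral_le_of_norm_le_const (μ := μ) (f := G i) (C := 1)
      (Eventually.of_forall fun z => by simpa [Real.norm_eq_abs] using hG1 i z)
    simpa [Real.norm_eq_abs] using hh
  have hGhb : ∀ i z, |Gh i z| ≤ 2 := fun i z => (abs_sub _ _).trans (by linarith [hG1 i z, hm1 i])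
  have hGhi : ∀ i (ν : Measure (GaugeConfig 3 L (Matrix.specialUnitaryGroup (Fin 2) ℂ))) [IsProbabilityMeasure ν], Integrable (Gh i) ν :=
    fun i ν _ => (integrable_const (2 : ℝ)).mono' (hGhc i).measurable.aestronglyMeasurable
      (Eventually.of_forall fun z => by rw [Real.norm_eq_abs]; exact hGhb i z)
  -- kernel action is linear
  have hκlin : ∀ (t : ℝ≥0) y, ∫ z, (∑ j, x j * Gh j z) ∂(κ t y) = ∑ j, x j * ∫ z, Gh j z ∂(κ t y) := fun t y => by
    rw [integral_finsetSum _ fun j _ => (hGhi j _).const_mul _]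
    exact Finset.sum_congr rfl fun j _ => integral_const_mul _ _
  have hκm : ∀ j (t : ℝ≥0), Measurable fun y => ∫ z, Gh j z ∂(κ t y) := fun j t =>
    ((hGhc j).measurable.stronglyMeasurable.integral_kernel (κ := κ t)).measurable
  have hκb : ∀ j (t : ℝ≥0) y, |∫ z, Gh j z ∂(κ t y)| ≤ 2 := fun j t y => by
    have hh := norm_integral_le_of_norm_le_const (μ := κ t y) (f := Gh j) (C := 2)
      (Eventually.of_forall fun z => by simpa [Real.norm_eq_abs] using hGhb j z)
    simpa [Real.norm_eq_abs] using hh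
  -- the `μ`-integral of the double sum
  have hprod_i : ∀ i j (t : ℝ≥0), Integrable (fun y => Gh i y * ∫ z, Gh j z ∂(κ t y)) μ := fun i j t =>
    (integrable_const (2 * 2 : ℝ)).mono' ((hGhc i).measurable.mul (hκm j t)).aestronglyMeasurable
      (Eventually.of_forall fun y => by
        rw [Real.norm_eq_abs, abs_mul]; exact mul_le_mul (hGhb i y) (hκb j t y) (abs_nonneg _) (by norm_num))
  have hinner : ∀ t : ℝ≥0, ∫ y, (∑ i, x i * Gh i y) * (∫ z, (∑ j, x j * Gh j z) ∂(κ t y)) ∂μ =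
      ∑ i, ∑ j, x i * x j * ∫ y, Gh i y * (∫ z, Gh j z ∂(κ t y)) ∂μ := by
    intro t
    have hpt : ∀ y, (∑ i, x i * Gh i y) * (∫ z, (∑ j, x j * Gh j z) ∂(κ t y)) =
        ∑ i, ∑ j, x i * x j * (Gh i y * ∫ z, Gh j z ∂(κ t y)) := fun y => by
      rw [hκlin, Finset.sum_mul]
      refine Finset.sum_congr rfl fun i _ => ?_
      rw [Finset.mul_sum]
      exact Finset.sum_congr rfl fun j _ => by ring
    rw [integral_congr_ae (ae_of_all _ hpt), integral_finsetSum _ fun i _ => ?_]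
    · refine Finset.sum_congr rfl fun i _ => ?_
      rw [integral_finsetSum _ fun j _ => (hprod_i i j t).const_mul _]
      exact Finset.sum_congr rfl fun j _ => integral_const_mul _ _
    · exact integrable_finsetSum _ fun j _ => (hprod_i i j t).const_mul _
  -- the time integral of the double sum
  have hcross : ∀ i j, IntegrableOn (fun t : ℝ => ∫ y, Gh i y * (∫ z, Gh j z ∂(κ t.toNNReal y)) ∂μ) (Ioi (0 : ℝ)) := fun i j =>
    (integrableOn_crossCorrelation L β' κ hreal (hGhc i) (hGhb i) (hGc j) (hG1 j)).2
  have heqt : (fun t : ℝ => ∫ y, (∑ i, x i * Gh i y) * (∫ z, (∑ j, x j * Gh j z) ∂(κ t.toNNReal y)) ∂μ) =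
      fun t : ℝ => ∑ i, ∑ j, x i * x j * ∫ y, Gh i y * (∫ z, Gh j z ∂(κ t.toNNReal y)) ∂μ := funext fun t => hinner _
  show ∫ t in Ioi (0 : ℝ), (∫ y, (∑ i, x i * Gh i y) * (∫ z, (∑ j, x j * Gh j z) ∂(κ t.toNNReal y)) ∂μ) =
    ∑ i, ∑ j, x i * x j * ∫ t in Ioi (0 : ℝ), (∫ y, Gh i y * (∫ z, Gh j z ∂(κ t.toNNReal y)) ∂μ)
  rw [heqt, integral_finsetSum _ fun i _ => ?_]
  · refine Finset.sum_congr rfl fun i _ => ?_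
    rw [integral_finsetSum _ fun j _ => ((hcross i j).const_mul _)]
    exact Finset.sum_congr rfl fun j _ => integral_const_mul _ _
  · exact integrable_finsetSum _ fun j _ => (hcross i j).const_mul _

end Summit.QuantumFields.YangMills.Theorems.ColdStartUniversality

end
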